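import Summits.HubbardSuperconductivity.HubbardSuperconductivity.Theses.ChiralWindow
import Literature.MathematicalPhysics.QuantumLattice.DWaveOrderParameterProofs

/-!
# Birth skeleton (BC3) of the split child (M) `CwDWaveOrderFloorOnLeadingWindows` — the STAIR SPLIT (UP)/(IR)

Redirect strategist r1 (planner-cstrat-stmt-HubbardSuperconductivity-1740-r1-0), 2026-08-17; typed and first kernel-checked by
the gen-1 strategist (`Cruxes/CwChiralConstruction/StrategyCensusG1.lean` §D6, theorems `M_of_UP_of_IR`, `UP_of_M`).

(M) = the Kohn–Luttinger mechanism in local uniform form (child 2 of the route-level split of crux `CwChiralConstruction`,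
stmt-HubbardSuperconductivity-1740; statement verbatim = registered stub `stub_dWaveOrderFloorOnLeadingWindows`). Its own
two-piece structure is the cut along the SOURCE STRENGTH at a `U`-dependent stair `h₁(U) = exp(-C₁/U²)` of the Koma–Tasaki
staircase `F(U,μ,h) = liminf_L m_{L+1}(h)` (Disproof §A `le_dWaveOrderParameter_iff_forall`):

* `stub_stairFloorOnLeadingWindows` (UP) — a floor `exp(-C/U²)` on the ONE stair `F(U, μ, h₁(U))`, source ON (massive `U(1)`
  phase mode; contains the symmetric regime bandwidth → ladder scale and the explicitly seeded broken regime down to `h₁`, but NO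
  massless Goldstone boson). Strictly weaker than (M) (`UP_of_M` in the companion). Open: no sourced point below `h ~ e^{-a/U}`
  is reachable by variational / perturbative means (census gen 1 §D6 (a)–(d); barrier `WeakCouplingCeiling`).
* `stub_sourceRemovalStabilityOnLeadingWindows` (IR) — a `U`-UNIFORM ratio `θ > 0`: `θ·F(U,μ,h₁(U)) ≤ F(U,μ,h)` for all
  `h ∈ (0, h₁(U))` (the Goldstone half, record-free; Balaban / Fröhlich–Spencer class at large stiffness WITHOUT reflection
  positivity). Independent of (M) (uniform θ). Open in every `d ≥ 2`.
* `CwDWaveOrderFloorOnLeadingWindows_of : (UP) → (IR) → (M)` — PROVED (staircase iff + monotonicity of `F` in `h` +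
  `exp(-(C+c)/U²) ≤ θ·exp(-C/U²)` for `c ≥ log(1/θ)`, `U ≤ 1`).

`lean check`: rc 0, sorries ONLY in the two `stub_*`. Probes (folder bc/Probe_UP.out, bc/Probe_IR.out): each stub → (M), → the
parent crux, → the summit, and the converses all FAIL under `first | exact? | simpa | unfold; simpa | aesop`; `#h21_crux_probe` CLEAN
for both (P2 hypotheses not vacuous, P3 no rigidity template closes).
-/

set_option linter.dupNamespace false

noncomputable section

namespace Summit.HubbardSuperconductivity.HubbardSuperconductivity.Cruxes.CwDWaveOrderFloorOnLeadingWindows.StairSplit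

open Literature.MathematicalPhysics.QuantumLattice Filter
open scoped Topology

/-- The Kohn–Luttinger leading hypothesis on a level window (hypothesis shape of (M), (UP), (IR)). -/
def KLLeadingOn (μ₁ μ₂ γ U₁ : ℝ) : Prop :=
  ∀ U ∈ Set.Ioo (0:ℝ) U₁, ∀ μ ∈ Set.Icc μ₁ μ₂, ∀ χ : D4Irrep, χ ≠ D4Irrep.B1g →
    channelInf (squareDispersion 1 0) μ U D4Irrep.B1g + γ * U ^ 2 ≤ channelInf (squareDispersion 1 0) μ U χ

/-- (M), verbatim (= child `CwDWaveOrderFloorOnLeadingWindows` of route ChiralWindow = stub `stub_dWaveOrderFloorOnLeadingWindows`). -/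
def M : Prop :=
  ∀ μ₁ μ₂ γ U₁ : ℝ, -2 ≤ μ₁ → μ₁ < μ₂ → μ₂ ≤ -(3:ℝ) / 10 → 0 < γ → 0 < U₁ → (∀ U ∈ Set.Ioo (0:ℝ) U₁, ∀ μ ∈ Set.Icc μ₁ μ₂, ∀ χ : Literature.MathematicalPhysics.QuantumLattice.D4Irrep, χ ≠ Literature.MathematicalPhysics.QuantumLattice.D4Irrep.B1g → Literature.MathematicalPhysics.QuantumLattice.channelInf (Literature.MathematicalPhysics.QuantumLattice.squareDispersion 1 0) μ U Literature.MathematicalPhysics.QuantumLattice.D4Irrep.B1g + γ * U ^ 2 ≤ Literature.MathematicalPhysics.QuantumLattice.channelInf (Literature.MathematicalPhysics.QuantumLattice.squareDispersion 1 0) μ U χ) → ∃ U₀ C : ℝ, 0 < U₀ ∧ 0 < C ∧ ∀ U ∈ Set.Ioo (0:ℝ) U₀, ∀ μ ∈ Set.Icc (μ₁ + U / 2) μ₂, Real.exp (-C / U ^ 2) ≤ Literature.MathematicalPhysics.QuantumLattice.dWaveOrderParameter U μ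

/-- The stair `F(U,μ,h) = liminf_L m_{L+1}(h)` of the Koma–Tasaki staircase (Disproof §A). -/
def stair (U μ h : ℝ) : ℝ :=
  liminf (fun L : ℕ => dWaveSourceDensity (L + 1) U μ h) atTop

/-- The `U`-dependent stair height `h₁(U) = exp(-C₁/U²)`. -/
def stairHeight (C₁ U : ℝ) : ℝ := Real.exp (-C₁ / U ^ 2)

theorem stairHeight_pos (C₁ U : ℝ) : 0 < stairHeight C₁ U := Real.exp_pos _

/-- **stub (UP)** — fixed-source floor at the `U`-dependent stair: on every KL-leading level window `⊂ [-2,-3/10]` and for EVERY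
stair exponent `C₁ > 0`, a floor `exp(-C/U²) ≤ F(U, μ, exp(-C₁/U²))`, all `U < U₀`, all operator levels `μ ∈ [μ₁+U/2, μ₂]`.
Plausibly true (the free response alone is `≈ ρ_d h₁ log(W/h₁) ≫ e^{-C/U²}` and the interacting one should keep an exponentially
small fraction of it); XL: needs the multiscale construction of the SOURCED repulsive model below `e^{-a/U}` (sign-resolved
symmetric flow + seeded massive broken regime). Leans on: `dWaveSourceDensity`, `channelInf`; barrier WeakCouplingCeiling head-on. -/
theorem stub_stairFloorOnLeadingWindows :
    ∀ μ₁ μ₂ γ U₁ : ℝ, -2 ≤ μ₁ → μ₁ < μ₂ → μ₂ ≤ -(3:ℝ) / 10 → 0 < γ → 0 < U₁ → KLLeadingOn μ₁ μ₂ γ U₁ →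
      ∀ C₁ : ℝ, 0 < C₁ → ∃ U₀ C : ℝ, 0 < U₀ ∧ 0 < C ∧ ∀ U ∈ Set.Ioo (0:ℝ) U₀, ∀ μ ∈ Set.Icc (μ₁ + U / 2) μ₂,
        Real.exp (-C / U ^ 2) ≤ stair U μ (stairHeight C₁ U) := by
  sorry

/-- **stub (IR)** — source-removal stability (the Goldstone half): on every KL-leading level window there are `C₁, θ, U₀ > 0`
with `θ · F(U, μ, exp(-C₁/U²)) ≤ F(U, μ, h)` for every `h ∈ (0, exp(-C₁/U²))`, all `U < U₀`, all operator levels. Plausibly true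
(physically `θ → 1`: below the gap scale the source only pins the phase); XL: the infrared `(2+1)`-dimensional `U(1)` phase
analysis at stiffness `∼ e^{+C/U²}` without reflection positivity (Balaban / Fröhlich–Spencer / Kennedy–King class), no template
for a fermionic system in print. Leans on: `dWaveSourceDensity`; barrier LROForcesLowLyingStates (consistent: Goldstone modes). -/
theorem stub_sourceRemovalStabilityOnLeadingWindows :
    ∀ μ₁ μ₂ γ U₁ : ℝ, -2 ≤ μ₁ → μ₁ < μ₂ → μ₂ ≤ -(3:ℝ) / 10 → 0 < γ → 0 < U₁ → KLLeadingOn μ₁ μ₂ γ U₁ →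
      ∃ C₁ θ U₀ : ℝ, 0 < C₁ ∧ 0 < θ ∧ 0 < U₀ ∧ ∀ U ∈ Set.Ioo (0:ℝ) U₀, ∀ μ ∈ Set.Icc (μ₁ + U / 2) μ₂,
        ∀ h ∈ Set.Ioo (0:ℝ) (stairHeight C₁ U), θ * stair U μ (stairHeight C₁ U) ≤ stair U μ h := by
  sorry

/-- Arithmetic of the glue: for `0 < U ≤ 1` and `c ≥ -log θ`, `c ≥ 0` (`0 < θ`), `exp(-(C+c)/U²) ≤ θ·exp(-C/U²)`. -/
theorem exp_shift_le_mul {U C c θ : ℝ} (hU : 0 < U) (hU1 : U ≤ 1) (hθ : 0 < θ) (hc : -Real.log θ ≤ c)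
    (hc0 : 0 ≤ c) :
    Real.exp (-(C + c) / U ^ 2) ≤ θ * Real.exp (-C / U ^ 2) := by
  have hU2 : 0 < U ^ 2 := by positivity
  have hU2le : U ^ 2 ≤ 1 := by nlinarith
  have hsplit : -(C + c) / U ^ 2 = -C / U ^ 2 + -c / U ^ 2 := by ring
  rw [hsplit, Real.exp_add, mul_comm]
  refine mul_le_mul_of_nonneg_right ?_ (Real.exp_pos _).le
  have h1 : -c / U ^ 2 ≤ -c := by
    rw [div_le_iff₀ hU2]
    nlinarith
  have h2 : Real.exp (-c) ≤ θ := by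
    have : -c ≤ Real.log θ := by linarith
    calc Real.exp (-c) ≤ Real.exp (Real.log θ) := Real.exp_le_exp.mpr this
      _ = θ := Real.exp_log hθ
  exact (Real.exp_le_exp.mpr h1).trans h2

/-- **(UP) → (IR) → (M)** — the composition of (M)'s birth skeleton (real proof; first kernel-checked as `M_of_UP_of_IR` in
`Cruxes/CwChiralConstruction/StrategyCensusG1.lean`). Pick `C₁, θ` from (IR); (UP) at that `C₁` gives `exp(-C/U²)` on the stair
`h₁(U)`; below the stair (IR) keeps `θ·exp(-C/U²) ≥ exp(-(C+c)/U²)` (`c = max 0 (-log θ)`, `U ≤ 1`); at or above the stair the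
staircase is non-decreasing (`liminf_dWaveSourceDensity_mono`); `le_dWaveOrderParameter_iff_forall` concludes.
[cite: KomaTasaki1994, §1] -/
theorem CwDWaveOrderFloorOnLeadingWindows_of :
    (∀ μ₁ μ₂ γ U₁ : ℝ, -2 ≤ μ₁ → μ₁ < μ₂ → μ₂ ≤ -(3:ℝ) / 10 → 0 < γ → 0 < U₁ → KLLeadingOn μ₁ μ₂ γ U₁ →
      ∀ C₁ : ℝ, 0 < C₁ → ∃ U₀ C : ℝ, 0 < U₀ ∧ 0 < C ∧ ∀ U ∈ Set.Ioo (0:ℝ) U₀, ∀ μ ∈ Set.Icc (μ₁ + U / 2) μ₂,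
        Real.exp (-C / U ^ 2) ≤ stair U μ (stairHeight C₁ U)) →
    (∀ μ₁ μ₂ γ U₁ : ℝ, -2 ≤ μ₁ → μ₁ < μ₂ → μ₂ ≤ -(3:ℝ) / 10 → 0 < γ → 0 < U₁ → KLLeadingOn μ₁ μ₂ γ U₁ →
      ∃ C₁ θ U₀ : ℝ, 0 < C₁ ∧ 0 < θ ∧ 0 < U₀ ∧ ∀ U ∈ Set.Ioo (0:ℝ) U₀, ∀ μ ∈ Set.Icc (μ₁ + U / 2) μ₂,
        ∀ h ∈ Set.Ioo (0:ℝ) (stairHeight C₁ U), θ * stair U μ (stairHeight C₁ U) ≤ stair U μ h) →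
    M := by
  intro hUP hIR μ₁ μ₂ γ U₁ hμ₁ h12 hμ₂ hγ hU₁ hK
  have hK' : KLLeadingOn μ₁ μ₂ γ U₁ := hK
  obtain ⟨C₁, θ, U₀', hC₁, hθ, hU₀', HIR⟩ := hIR μ₁ μ₂ γ U₁ hμ₁ h12 hμ₂ hγ hU₁ hK'
  obtain ⟨U₀'', C, hU₀'', hC, HUP⟩ := hUP μ₁ μ₂ γ U₁ hμ₁ h12 hμ₂ hγ hU₁ hK' C₁ hC₁
  set c : ℝ := max 0 (-Real.log θ) with hc
  have hc0 : 0 ≤ c := le_max_left _ _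
  have hcl : -Real.log θ ≤ c := le_max_right _ _
  refine ⟨min (min U₀' U₀'') 1, C + c, lt_min (lt_min hU₀' hU₀'') one_pos, by linarith, fun U hU μ hμ => ?_⟩
  have hU0 : 0 < U := hU.1
  have hU' : U < U₀' := lt_of_lt_of_le hU.2 ((min_le_left _ _).trans (min_le_left _ _))
  have hU'' : U < U₀'' := lt_of_lt_of_le hU.2 ((min_le_left _ _).trans (min_le_right _ _))
  have hU1 : U ≤ 1 := (lt_of_lt_of_le hU.2 (min_le_right _ _)).le
  have hfloor : Real.exp (-C / U ^ 2) ≤ stair U μ (stairHeight C₁ U) := HUP U ⟨hU0, hU''⟩ μ hμ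
  have hshift : Real.exp (-(C + c) / U ^ 2) ≤ θ * Real.exp (-C / U ^ 2) := exp_shift_le_mul hU0 hU1 hθ hcl hc0
  have hθexp : θ * Real.exp (-C / U ^ 2) ≤ Real.exp (-C / U ^ 2) := by
    by_cases hθ1 : θ ≤ 1
    · have := Real.exp_pos (-C / U ^ 2)
      nlinarith
    · exfalso
      have hh : stairHeight C₁ U / 2 ∈ Set.Ioo (0:ℝ) (stairHeight C₁ U) :=
        ⟨by have := stairHeight_pos C₁ U; linarith, by have := stairHeight_pos C₁ U; linarith⟩
      have h1 := HIR U ⟨hU0, hU'⟩ μ hμ _ hh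
      have h2 : stair U μ (stairHeight C₁ U / 2) ≤ stair U μ (stairHeight C₁ U) :=
        liminf_dWaveSourceDensity_mono U μ hh.1.le hh.2.le
      have h3 : stair U μ (stairHeight C₁ U) ≤ 0 := by nlinarith
      have h4 : 0 < Real.exp (-C / U ^ 2) := Real.exp_pos _
      linarith
  show Real.exp (-(C + c) / U ^ 2) ≤ dWaveOrderParameter U μ
  rw [le_dWaveOrderParameter_iff_forall]
  intro h hh
  by_cases hlt : h < stairHeight C₁ U
  · have := HIR U ⟨hU0, hU'⟩ μ hμ h ⟨hh, hlt⟩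
    calc Real.exp (-(C + c) / U ^ 2) ≤ θ * Real.exp (-C / U ^ 2) := hshift
      _ ≤ θ * stair U μ (stairHeight C₁ U) := mul_le_mul_of_nonneg_left hfloor hθ.le
      _ ≤ stair U μ h := this
  · have hle : stairHeight C₁ U ≤ h := not_lt.mp hlt
    calc Real.exp (-(C + c) / U ^ 2) ≤ θ * Real.exp (-C / U ^ 2) := hshift
      _ ≤ Real.exp (-C / U ^ 2) := hθexp
      _ ≤ stair U μ (stairHeight C₁ U) := hfloor
      _ ≤ stair U μ h := liminf_dWaveSourceDensity_mono U μ (stairHeight_pos C₁ U).le hle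

/-- The skeleton composes: (M) from the two stubs. -/
theorem M_of_stubs : M :=
  CwDWaveOrderFloorOnLeadingWindows_of stub_stairFloorOnLeadingWindows stub_sourceRemovalStabilityOnLeadingWindows

end Summit.HubbardSuperconductivity.HubbardSuperconductivity.Cruxes.CwDWaveOrderFloorOnLeadingWindows.StairSplit

end
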